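import Literature.AlgebraicGeometry.HodgeTheory.SymbolClasses
import Literature.AlgebraicGeometry.HodgeTheory.HodgeTypeDimension
import Literature.NumberTheory.Transcendental.ComplexFormsHighType

/-!
# `SymbolClassesAlgebraic` (stmt-HodgeConjecture-17743) · Negative · boundary and load-bearing hypotheses

Negative knowledge for the crux `MilnorKExponential.SymbolClassesAlgebraic` (GK_p: rational symbol
classes of weight `p = q + 1` — classes carried, on a symbol-normalised Hodge model, by a Čech
`p`-cocycle of holomorphic Milnor symbols — are algebraic), from the standing disprover's work file
`Cruxes/SymbolClassesAlgebraic/Disproof.lean` (§2–§4, §6), stated over the named forms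
`HodgeModel.IsSymbolNormalized` / `HodgeModel.HasSymbolCocycle` of
`Literature/AlgebraicGeometry/HodgeTheory/SymbolClasses`, of which the route decl is componentwise
definitionally the universal closure (`Negative/Ceiling.lean` records that read-back and the ceiling
`¬ GK ⇒ ¬ HC`; this file needs only the Literature layer).

* BOUNDARY. In degrees `2(q+1) > 2n` no Hodge model is symbol-normalised
  (`not_isSymbolNormalized_of_lt`), only `0` carries a symbol cocycle
  (`eq_zero_of_hasSymbolCocycle_of_lt`), and the crux's conclusion holds outright
  (`mem_algebraicClasses_of_lt`) — unconditionally (no support item used). Content lives in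
  `q + 1 ≤ n`; first open case `(n, p) = (4, 2)`.
* LOAD-BEARING HYPOTHESES. With `m ≠ 0` deleted, `(σ, θ, m) = (0, 0, 0)` is a symbol cocycle for
  EVERY class (`hasSymbolCocycle_without_nonzero`); with the covering clause `∀ x, ∃ i, x ∈ U i`
  deleted, the EMPTY cover makes every closed form a transgression and every class a symbol class with
  `m = 1` (`hasSymbolCocycle_without_cover`). Either way the weakened crux says "every rational class of
  a symbol-normalisable degree is algebraic", false on abelian / K3 surfaces in degree `2`; the witness
  (a rational non-algebraic class next to a normalised model) is not yet constructible on the tree's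
  carriers and enters as a hypothesis (`symbolClassesAlgebraic_false_without_nonzero`,
  `symbolClassesAlgebraic_false_without_cover`).
* ANTI-VACUITY modulo normalisation, weight `1`: a normalisation witness in degree `2` is itself a
  non-zero rational symbol class (`exists_ne_zero_hasSymbolCocycle_of_isSymbolNormalized_zero`).
Refuter seat refuter-cdisprove-stmt-HodgeConjecture-17743-0 (cdisprove cycle 1), 2026-08-17.
-/

noncomputable section

-- The mandated namespace `Summit.<P>.<Sub>.Theorems.…` repeats `HodgeConjecture` (single-conjunct summit).
set_option linter.dupNamespace false

namespace Summit.HodgeConjecture.HodgeConjecture.Theorems.SymbolClassesAlgebraic.Negative.LoadBearing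

open scoped Manifold
open Literature.AlgebraicGeometry.HodgeTheory Literature.AlgebraicGeometry.Motives
  Literature.Geometry.Kaehler Literature.NumberTheory.Transcendental

/-! ### Boundary: above the dimension the hypothesis is empty and the crux holds outright -/

variable {n : ℕ} {X : SchemeOver ℂ}

/-- **No Hodge model is symbol-normalised in a degree `2(q+1) > 2n`**: the normalising form `θ₀` is a
`(2q+2)`-form on a real `2n`-manifold, hence `0` (`mform_eq_zero_of_two_mul_finrank_lt`,
`dim_ℂ A.model = n`), so `A^* c₀ = A.deRham [0] = 0` and `c₀ = 0` (`pullback_injective`),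
contradicting `c₀ ≠ 0`. [cite: VoisinHodgeI2002, §2.3.1] -/
theorem not_isSymbolNormalized_of_lt (A : HodgeModel n X) {q : ℕ} (hq : n < q + 1) :
    ¬ A.IsSymbolNormalized q := by
  rintro ⟨ι, _, L, θ₀, c₀, _, _, hc₀, hdR⟩
  have hθ : θ₀ = 0 :=
    Subtype.ext (mform_eq_zero_of_two_mul_finrank_lt _ (by rw [A.isAnalytification.finrank_eq]; omega))
  refine hc₀ (A.pullback_injective (2 * q + 1 + 1) ?_)
  rw [← hdR, hθ, map_zero, map_zero, map_zero]

/-- **Above the dimension only `0` carries a symbol cocycle**: `θ = 0` for the same reason, so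
`m • A^* c = 0` with `m ≠ 0`, i.e. `c = 0`. [cite: VoisinHodgeI2002, §2.3.1] -/
theorem eq_zero_of_hasSymbolCocycle_of_lt (A : HodgeModel n X) {q : ℕ} (hq : n < q + 1)
    {c : complexBetti X (2 * (q + 1))} (h : A.HasSymbolCocycle q c) : c = 0 := by
  obtain ⟨ι, _, U, hU, hcov, σ, hσ, θ, m, hm, hT, hdR⟩ := h
  have hθ : θ = 0 :=
    Subtype.ext (mform_eq_zero_of_two_mul_finrank_lt _ (by rw [A.isAnalytification.finrank_eq]; omega))
  rw [hθ, map_zero, map_zero, eq_comm, smul_eq_zero] at hdR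
  rcases hdR with hm0 | h0
  · exact absurd (Int.cast_eq_zero.1 hm0) hm
  · exact A.pullback_injective (2 * q + 1 + 1) (by rw [h0, map_zero])

/-- **The crux holds outright in every degree `2(q+1) > 2n`** (its hypothesis is even unsatisfiable
there, `not_isSymbolNormalized_of_lt`; a class with a symbol cocycle is `0`, which is algebraic) —
without the support item `L ⊆ Hdg`. Proofs and disproofs live in `q + 1 ≤ n`. [folklore] -/
theorem mem_algebraicClasses_of_lt (hX : IsSmoothProjective n X) {q : ℕ} (hq : n < q + 1)
    (c : complexBetti X (2 * (q + 1))) (hc : IsRationalClass c)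
    (hs : ∃ A : HodgeModel n X, A.IsSymbolNormalized q ∧ A.HasSymbolCocycle q c) :
    c ∈ algebraicClasses X (q + 1) := by
  have _ := hX; have _ := hc
  obtain ⟨A, -, hS⟩ := hs
  rw [eq_zero_of_hasSymbolCocycle_of_lt A hq hS]
  exact Submodule.zero_mem _

/-! ### Load-bearing: the integer multiple must be non-zero -/

/-- **Without `m ≠ 0` EVERY class has a symbol cocycle** (the clause `A.HasSymbolCocycle q c` with
`m ≠ 0` deleted holds for all `c`): one-set cover, `σ = 0`, the zero zig-zag, `θ = 0`, `m = 0`.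
[folklore] -/
theorem hasSymbolCocycle_without_nonzero (A : HodgeModel n X) (q : ℕ)
    (c : complexBetti X (2 * (q + 1))) :
    ∃ (ι : Type) (_ : Fintype ι) (U : ι → Set A.carrier) (hU : ∀ i, IsOpen (U i))
      (_ : ∀ x, ∃ i, x ∈ U i) (σ : (Fin (q + 2) → ι) → ((Fin (q + 1) → (A.carrier → ℂ)) →₀ ℤ))
      (_ : IsMilnorSymbolCocycle A.model U σ)
      (θ : cclosedSmoothForms A.model A.carrier (2 * q + 1 + 1)) (m : ℤ),
      IsTransgression hU q (fun J ↦ symbolForm A.model (q + 1) (σ J)) θ ∧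
        A.deRham A.carrier (2 * q + 1 + 1)
            (complexDeRhamCohomology.mk A.model A.carrier (2 * q + 1 + 1) θ) =
          (m : ℂ) • A.pullback (2 * q + 1 + 1) c := by
  refine ⟨Unit, inferInstance, fun _ ↦ Set.univ, fun _ ↦ isOpen_univ, fun x ↦ ⟨(), Set.mem_univ x⟩,
    0, isMilnorSymbolCocycle_zero _, 0, 0, ?_, ?_⟩
  · refine ⟨fun _ _ ↦ 0, fun J x _ ↦ ?_, fun a b _ _ ↦ ?_, fun J x _ ↦ ?_⟩
    · simp only [map_zero, Pi.zero_apply, symbolForm_zero, ZeroMemClass.coe_zero]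
    · simp only [map_zero]
    · simp only [map_zero, Pi.zero_apply, ZeroMemClass.coe_zero]
  · simp only [map_zero, Int.cast_zero, zero_smul]

/-- **`m ≠ 0` is load-bearing.** The crux with `m ≠ 0` deleted is false as soon as one smooth
projective variety carries, next to a symbol-normalised model in degree `2(q+1)`, a rational class
that is not algebraic (abelian / K3 surfaces, `q = 0`: `b₂ > ρ` and algebraic classes are of type
`(1,1)`; witness not yet constructible on the tree's carriers). [cite: VoisinHodgeI2002, §11.3] -/
theorem symbolClassesAlgebraic_false_without_nonzero
    (hw : ∃ (n : ℕ) (X : SchemeOver ℂ) (q : ℕ) (A : HodgeModel n X) (c : complexBetti X (2 * (q + 1))),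
      IsSmoothProjective n X ∧ A.IsSymbolNormalized q ∧ IsRationalClass c ∧
        c ∉ algebraicClasses X (q + 1)) :
    ¬ (∀ ⦃n : ℕ⦄ ⦃X : SchemeOver ℂ⦄, IsSmoothProjective n X →
        ∀ (q : ℕ) (c : complexBetti X (2 * (q + 1))), IsRationalClass c →
          (∃ A : HodgeModel n X, A.IsSymbolNormalized q ∧
            ∃ (ι : Type) (_ : Fintype ι) (U : ι → Set A.carrier) (hU : ∀ i, IsOpen (U i))
              (_ : ∀ x, ∃ i, x ∈ U i)
              (σ : (Fin (q + 2) → ι) → ((Fin (q + 1) → (A.carrier → ℂ)) →₀ ℤ))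
              (_ : IsMilnorSymbolCocycle A.model U σ)
              (θ : cclosedSmoothForms A.model A.carrier (2 * q + 1 + 1)) (m : ℤ),
              IsTransgression hU q (fun J ↦ symbolForm A.model (q + 1) (σ J)) θ ∧
                A.deRham A.carrier (2 * q + 1 + 1)
                    (complexDeRhamCohomology.mk A.model A.carrier (2 * q + 1 + 1) θ) =
                  (m : ℂ) • A.pullback (2 * q + 1 + 1) c) →
          c ∈ algebraicClasses X (q + 1)) := by
  intro h
  obtain ⟨n, X, q, A, c, hX, hN, hc, hna⟩ := hw
  exact hna (h hX q c hc ⟨A, hN, hasSymbolCocycle_without_nonzero A q c⟩)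

/-! ### Load-bearing: the open sets must cover `X^an` -/

/-- **Without the covering clause EVERY class has a symbol cocycle with `m = 1`** (the clause
`A.HasSymbolCocycle q c` with `∀ x, ∃ i, x ∈ U i` deleted holds for all `c`): on the EMPTY cover
(index type `Empty`, finite) all cochain types are singletons, every condition of
`IsMilnorSymbolCocycle` and of the zig-zag is vacuous, and `θ` may be any closed form — one
representing `A.deRham⁻¹ (A^* c)`. [cite: BottTu1982Forms, §8 Prop. 8.8] -/
theorem hasSymbolCocycle_without_cover (A : HodgeModel n X) (q : ℕ)
    (c : complexBetti X (2 * (q + 1))) :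
    ∃ (ι : Type) (_ : Fintype ι) (U : ι → Set A.carrier) (hU : ∀ i, IsOpen (U i))
      (σ : (Fin (q + 2) → ι) → ((Fin (q + 1) → (A.carrier → ℂ)) →₀ ℤ))
      (_ : IsMilnorSymbolCocycle A.model U σ)
      (θ : cclosedSmoothForms A.model A.carrier (2 * q + 1 + 1)) (m : ℤ),
      m ≠ 0 ∧ IsTransgression hU q (fun J ↦ symbolForm A.model (q + 1) (σ J)) θ ∧
        A.deRham A.carrier (2 * q + 1 + 1)
            (complexDeRhamCohomology.mk A.model A.carrier (2 * q + 1 + 1) θ) =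
          (m : ℂ) • A.pullback (2 * q + 1 + 1) c := by
  obtain ⟨θ, hθ⟩ := complexDeRhamCohomology.mk_surjective (E := A.model) (M := A.carrier)
    (k := 2 * q + 1 + 1) ((A.deRham A.carrier (2 * q + 1 + 1)).symm (A.pullback (2 * q + 1 + 1) c))
  refine ⟨Empty, inferInstance, fun i ↦ i.elim, fun i ↦ i.elim, fun J ↦ (J 0).elim,
    ⟨fun J ↦ (J 0).elim, fun J' ↦ (J' 0).elim⟩, θ, 1, one_ne_zero, ?_, ?_⟩
  · exact ⟨fun a b J ↦ (J 0).elim, fun J ↦ (J 0).elim, fun a b _ _ ↦ funext fun J ↦ (J 0).elim,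
      fun J ↦ (J 0).elim⟩
  · rw [hθ, LinearEquiv.apply_symm_apply, Int.cast_one, one_smul]

/-- **The covering clause is load-bearing** (it is the only clause through which `θ`, hence `c`, sees
the symbol data): the crux with `∀ x, ∃ i, x ∈ U i` deleted is false modulo the same transcendental
witness. [cite: BottTu1982Forms, §8 Prop. 8.8] -/
theorem symbolClassesAlgebraic_false_without_cover
    (hw : ∃ (n : ℕ) (X : SchemeOver ℂ) (q : ℕ) (A : HodgeModel n X) (c : complexBetti X (2 * (q + 1))),
      IsSmoothProjective n X ∧ A.IsSymbolNormalized q ∧ IsRationalClass c ∧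
        c ∉ algebraicClasses X (q + 1)) :
    ¬ (∀ ⦃n : ℕ⦄ ⦃X : SchemeOver ℂ⦄, IsSmoothProjective n X →
        ∀ (q : ℕ) (c : complexBetti X (2 * (q + 1))), IsRationalClass c →
          (∃ A : HodgeModel n X, A.IsSymbolNormalized q ∧
            ∃ (ι : Type) (_ : Fintype ι) (U : ι → Set A.carrier) (hU : ∀ i, IsOpen (U i))
              (σ : (Fin (q + 2) → ι) → ((Fin (q + 1) → (A.carrier → ℂ)) →₀ ℤ))
              (_ : IsMilnorSymbolCocycle A.model U σ)
              (θ : cclosedSmoothForms A.model A.carrier (2 * q + 1 + 1)) (m : ℤ),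
              m ≠ 0 ∧ IsTransgression hU q (fun J ↦ symbolForm A.model (q + 1) (σ J)) θ ∧
                A.deRham A.carrier (2 * q + 1 + 1)
                    (complexDeRhamCohomology.mk A.model A.carrier (2 * q + 1 + 1) θ) =
                  (m : ℂ) • A.pullback (2 * q + 1 + 1) c) →
          c ∈ algebraicClasses X (q + 1)) := by
  intro h
  obtain ⟨n, X, q, A, c, hX, hN, hc, hna⟩ := hw
  exact hna (h hX q c hc ⟨A, hN, hasSymbolCocycle_without_cover A q c⟩)

/-! ### Anti-vacuity in weight one, modulo normalisation -/

/-- **A normalisation witness in degree 2 is itself a non-zero rational symbol class**: the transition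
cocycle `(g_ij)` of the normalising line bundle is a Milnor symbol `1`-cocycle of weight `1`
(`HolomorphicLineBundle.isMilnorSymbolCocycle_symbolCochain_zero`), its symbol forms are the
normalising `dlog g_ij`, and `A.deRham [θ₀] = 1 • A^* c₀` with `c₀ ≠ 0` rational. So on a normalised
model the weight-1 crux speaks about a non-zero class. [cite: VoisinHodgeI2002, Thm. 4.49 and Thm. 7.10 (proof)] -/
theorem exists_ne_zero_hasSymbolCocycle_of_isSymbolNormalized_zero (A : HodgeModel n X)
    (hN : A.IsSymbolNormalized 0) :
    ∃ c₀ : complexBetti X (2 * (0 + 1)), IsRationalClass c₀ ∧ c₀ ≠ 0 ∧ A.HasSymbolCocycle 0 c₀ := by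
  obtain ⟨ι, hι, L, θ₀, c₀, hT, hc₀, hne, hdR⟩ := hN
  refine ⟨c₀, hc₀, hne, ι, hι, L.baseSet, L.isOpen_baseSet, L.exists_mem_baseSet, L.symbolCochain 0,
    L.isMilnorSymbolCocycle_symbolCochain_zero, θ₀, 1, one_ne_zero, hT, ?_⟩
  rw [hdR, Int.cast_one, one_smul]

end Summit.HodgeConjecture.HodgeConjecture.Theorems.SymbolClassesAlgebraic.Negative.LoadBearing

end
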